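/-
Copyright (c) 2026 the pub-hodgecm-mathlib formalisation cell (harness21).  Prover seat hodgecm-mathlib-K2E1-p15 (g0), Track B ∕ K2-LIT «5Res (c) MS-2(χ,τ)», h413 =
`stmt-HodgeConjecture-24833`, line `K2_E1_TraceFormulaBeta`, route of record `HCCMUnconditional`; deal (115) of dealer K2E1-plan (g6) 2026-09-04T11:01:54Z = SHEET
ROW 14 FILE 2, companion MODELS file (split from `K2E1ChiMaassSelbergContinuedCMTwo` for the 400-line law).
-/
import Summits.HodgeConjecture.HodgeConjecture.Theorems.K2E1ChiMaassSelbergContinuedCMTwo   -- FILE 2 (this seat): the bracket-letter heads `diag_eq_fourBracket_of_pairing_on`, `poleControl_continued_chi_cm_two_of_family_on`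
import HarnessLib

/-!
# K2·E1 — `K2E1ChiMaassSelbergContinuedModelsCMTwo`: THE BRACKET LETTERS OF ★ `K2E1ChiMaassSelbergContinuedCMTwo` DISCHARGED WHEN THE BRACKETS ARE INNER PRODUCTS —
# the self-dual model (`χ = χʷ`, four brackets `κm⟪·,·⟫` on one section space) and the off-dual model (`χ ≠ χʷ`, two-term relation, a `y`-FREE bound: no pole at all)

Track B ∕ K2-LIT, crux h413 = `stmt-HodgeConjecture-24833`; cell `hodgecm-mathlib`, squad K2, ENGINE E1, campaign «5Res», road «BL-2(χ,τ) ∘ MS-2(χ,τ) ∘ ARCH-UNITARITY ∘ R8₂»;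
SHEET row 14 FILE 2 companion.  THEOREMS ONLY (no `def`, no `instance`, no notation, no named-fact hypothesis, no `sorry`); lane `--kind proof --supports stmt-HodgeConjecture-24833
--as helper` (count-neutral).  Closes no socket.

THE MODELS ([MoeglinWaldspurger1995, IV.2.3, IV.3.12 (a)]; FILE 1 = ★ `K2E1ChiMaassSelbergCMTwo` (K2E1-p14): brackets `B₁ = κ⟨φ, φ⟩_K`, `B₄(z, z′) = κ⟨φ̃_z, φ̃_{z′}⟩_K`, cross brackets
with density `χ·conj χʷ`).  When the section space `V(χ, τ, U)` (★ p859551) is given the `K`-pairing as a complex inner product and `ψ(z) := M(z, χ)φ` is the continued intertwined section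
(holomorphic on `D₁`), the letters of FILE 2's heads are facts of Hilbert-space calculus: `z ↦ ⟪v, ψ z⟫` is holomorphic (`innerSL`), `w ↦ ⟪ψ(conj w), v⟫` is holomorphic on
`conj⁻¹ D₁` (Schwarz reflection ★ `differentiableOn_conj_comp_conj` + `inner_conj_symm`), `⟪v, v⟫ = ‖v‖²`, and Cauchy–Schwarz `‖⟪ψ z, φ⟫‖² ≤ ‖φ‖²‖ψ z‖²` (`norm_inner_le_norm`).
SELF-DUAL (`χ = χʷ`, all four brackets on ONE space): (a1)∧(a2)∧(a3) with `a = κm‖φ‖²`, `b(z) = κm‖ψ z‖²`.  OFF-DUAL (`χ ≠ χʷ`: the cross brackets vanish by orthogonality of characters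
on the compact norm-one idele class group, `ψ` valued in a second space `V′ = V(χʷ, τ, U)`): the diagonal two-term identity `‖F z‖² = cμK(T^{2x}∕(2x)·a − T^{−2x}∕(2x)·b(z)) ≥ 0`
gives the `y`-FREE bound `b(z) ≤ T^{4x}·a` on all of `D₁` — `M(z, χ)` is locally bounded near every point of `{Re z > ½}` reachable by `D₁`, so has NO pole there ([MW] IV.1.11: the
singularities in the positive chamber come from the self-associate data only).

* §1 `le_of_twoTerm` (two-term diagonal positivity ⟹ `b ≤ T^{4x}·a`), `inner_self_eq_ofReal_norm_sq`, `differentiableOn_inner_conj_comp`.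
* §2 **`poleControl_continued_chi_cm_two_of_family_selfDual_on`** — the self-dual model of ★ `poleControl_continued_chi_cm_two_of_family_on`.
* §3 **`normSq_le_of_family_offDual_on`** — the off-dual model: `κm‖ψ z‖² ≤ T^{4(Re z − ½)}·κm‖φ‖²` at every `z ∈ D₁` (★ `diag_eq_fourBracket_of_pairing_on` with `B₂ = B₃ = 0`, §1).

HONEST LABEL: HC_CM is proved only modulo the 7 printed citations (2 remaining named inputs: hLiu418 = `stmt-HodgeConjecture-24832`, h413 = `stmt-HodgeConjecture-24833`) until rung 0
closes; this file asserts no named fact, is conditional by construction on the relation letter `hrel`, and closes no socket.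

## References
* [MoeglinWaldspurger1995] C. Mœglin, J.-L. Waldspurger, *Spectral decomposition and Eisenstein series* (1995), IV.1.11, IV.2.3, IV.3.12 (a).
* [Arthur1980TraceFormulaII] J. Arthur, *A trace formula for reductive groups II*, Compositio Math. 40 (1980), §4.
* [Rudin1991] W. Rudin, *Functional Analysis* (2nd ed., 1991), Thm. 3.31 (vector-valued holomorphy through functionals).
-/

set_option autoImplicit false
set_option linter.dupNamespace false  -- the mandated namespace repeats the summit's segment (`HodgeConjecture.HodgeConjecture`)

noncomputable section

open Set Filter Topology
open scoped ComplexConjugate InnerProductSpace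
open Summit.HodgeConjecture.HodgeConjecture.Cruxes.H413.K2E1MaassSelbergPoleControlCMTwo (add_conj_sub_one_eq)
open Summit.HodgeConjecture.HodgeConjecture.Cruxes.H413.K2E1MaassSelbergContinuedCMTwo (differentiableOn_conj_comp_conj)
open Summit.HodgeConjecture.HodgeConjecture.Cruxes.H413.K2E1MaassSelbergPairingCMTwo (pairing_of_differentiableOn)
open Summit.HodgeConjecture.HodgeConjecture.Cruxes.H413.K2E1ChiMaassSelbergContinuedCMTwo (diag_eq_fourBracket_of_pairing_on poleControl_continued_chi_cm_two_of_family_on)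

namespace Summit.HodgeConjecture.HodgeConjecture.Cruxes.H413.K2E1ChiMaassSelbergContinuedModelsCMTwo

/-! ## §1 Scalar and Hilbert-space bookkeeping -/

section Prelim

/-- **DIAGONAL TWO-TERM POSITIVITY ⟹ `b ≤ T^{4x}·a`** (the `χ ≠ χʷ` case: no cross terms): from `0 ≤ Q = c₁·(c₂·(T^{s₁}∕s₁·a − T^{−s₁}∕s₁·b))` with `s₁ = 2x > 0`, `T > 0`, `c₁, c₂ > 0`.
[cite: MoeglinWaldspurger1995, IV.3.12 (a)] -/
theorem le_of_twoTerm {a b Q c₁ c₂ T x : ℝ} {s₁ : ℂ} (hc₁ : 0 < c₁) (hc₂ : 0 < c₂) (hT : 0 < T) (hx : 0 < x) (hQ : 0 ≤ Q)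
    (hs₁ : s₁ = ((2 * x : ℝ) : ℂ))
    (htwo : (Q : ℂ) = (c₁ : ℂ) * ((c₂ : ℂ) * ((T : ℂ) ^ s₁ / s₁ * (a : ℂ) - (T : ℂ) ^ (-s₁) / s₁ * (b : ℂ)))) :
    b ≤ T ^ (4 * x) * a := by
  subst hs₁
  have h1 : (T : ℂ) ^ (((2 * x : ℝ)) : ℂ) = (((T ^ (2 * x) : ℝ)) : ℂ) := (Complex.ofReal_cpow hT.le _).symm
  have h2 : (T : ℂ) ^ (-(((2 * x : ℝ)) : ℂ)) = (((T ^ (-(2 * x)) : ℝ)) : ℂ) := by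
    rw [← Complex.ofReal_neg]; exact (Complex.ofReal_cpow hT.le _).symm
  rw [h1, h2] at htwo
  have hreal : Q = c₁ * (c₂ * (T ^ (2 * x) / (2 * x) * a - T ^ (-(2 * x)) / (2 * x) * b)) := by exact_mod_cast htwo
  have hE : 0 ≤ T ^ (2 * x) / (2 * x) * a - T ^ (-(2 * x)) / (2 * x) * b := by
    have h := hQ
    rw [hreal] at h
    exact nonneg_of_mul_nonneg_right (nonneg_of_mul_nonneg_right h hc₁) hc₂
  have hpos : 0 < T ^ (2 * x) := Real.rpow_pos_of_pos hT _
  have hx2 : 0 < 2 * x := by linarith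
  have hneg : T ^ (-(2 * x)) = (T ^ (2 * x))⁻¹ := Real.rpow_neg hT.le _
  have h4 : T ^ (4 * x) = T ^ (2 * x) * T ^ (2 * x) := by
    rw [← Real.rpow_add hT]; ring_nf
  rw [hneg] at hE
  -- clear the positive denominator `2x`
  have hE' : (T ^ (2 * x))⁻¹ * b ≤ T ^ (2 * x) * a := by
    have h3 : T ^ (2 * x) / (2 * x) * a - (T ^ (2 * x))⁻¹ / (2 * x) * b = (T ^ (2 * x) * a - (T ^ (2 * x))⁻¹ * b) / (2 * x) := by ring
    rw [h3] at hE
    have h5 := (div_nonneg_iff.1 hE).resolve_right (fun h => (not_le.2 hx2) h.2)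
    linarith [h5.1]
  rw [h4]
  calc b = T ^ (2 * x) * ((T ^ (2 * x))⁻¹ * b) := by field_simp
    _ ≤ T ^ (2 * x) * (T ^ (2 * x) * a) := mul_le_mul_of_nonneg_left hE' hpos.le
    _ = T ^ (2 * x) * T ^ (2 * x) * a := by ring

variable {V : Type*} [NormedAddCommGroup V] [InnerProductSpace ℂ V]

/-- `⟪v, v⟫ = ‖v‖²` as a real cast into `ℂ`. [folklore] -/
theorem inner_self_eq_ofReal_norm_sq (v : V) : ⟪v, v⟫_ℂ = (((‖v‖ ^ 2 : ℝ)) : ℂ) := by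
  rw [inner_self_eq_norm_sq_to_K]
  push_cast
  rfl

/-- `κ·(m·⟪v, v⟫) = κm‖v‖²` as a real cast. [folklore] -/
theorem real_mul_inner_self (κ m : ℝ) (v : V) : ((κ : ℝ) : ℂ) * (((m : ℝ) : ℂ) * ⟪v, v⟫_ℂ) = (((κ * m * ‖v‖ ^ 2 : ℝ)) : ℂ) := by
  rw [inner_self_eq_ofReal_norm_sq]; push_cast; ring

/-- `w ↦ ⟪ψ(conj w), v⟫` is holomorphic on `conj⁻¹ D₁` when `ψ` is holomorphic on the open `D₁` (Schwarz reflection ★ `differentiableOn_conj_comp_conj` of `z ↦ ⟪v, ψ z⟫`, `inner_conj_symm`).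
[cite: Rudin1991, Thm. 3.31] -/
theorem differentiableOn_inner_conj_comp {D₁ : Set ℂ} (hD₁ : IsOpen D₁) {ψ : ℂ → V} (hψ : DifferentiableOn ℂ ψ D₁) (v : V) :
    DifferentiableOn ℂ (fun w : ℂ => ⟪ψ (conj w), v⟫_ℂ) {w : ℂ | conj w ∈ D₁} := by
  have h := differentiableOn_conj_comp_conj hD₁ ((innerSL ℂ v).differentiable.comp_differentiableOn hψ)
  refine h.congr fun w _ => ?_
  show ⟪ψ (conj w), v⟫_ℂ = conj ⟪v, ψ (conj w)⟫_ℂ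
  exact (inner_conj_symm _ _).symm

/-- Cauchy–Schwarz in bracket currency: `‖κ·(m·⟪u, v⟫)‖² ≤ (κm‖v‖²)·(κm‖u‖²)` for `κ, m ≥ 0`. [folklore] -/
theorem norm_sq_real_mul_inner_le {κ m : ℝ} (hκ : 0 ≤ κ) (hm : 0 ≤ m) (u v : V) :
    ‖((κ : ℝ) : ℂ) * (((m : ℝ) : ℂ) * ⟪u, v⟫_ℂ)‖ ^ 2 ≤ (κ * m * ‖v‖ ^ 2) * (κ * m * ‖u‖ ^ 2) := by
  rw [norm_mul, norm_mul, Complex.norm_real, Complex.norm_real, Real.norm_of_nonneg hκ, Real.norm_of_nonneg hm]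
  have hi : ‖⟪u, v⟫_ℂ‖ ≤ ‖u‖ * ‖v‖ := norm_inner_le_norm _ _
  have h2 : ‖⟪u, v⟫_ℂ‖ ^ 2 ≤ (‖u‖ * ‖v‖) ^ 2 := pow_le_pow_left₀ (norm_nonneg _) hi 2
  calc (κ * (m * ‖⟪u, v⟫_ℂ‖)) ^ 2 = (κ * m) ^ 2 * ‖⟪u, v⟫_ℂ‖ ^ 2 := by ring
    _ ≤ (κ * m) ^ 2 * (‖u‖ * ‖v‖) ^ 2 := mul_le_mul_of_nonneg_left h2 (sq_nonneg _)
    _ = (κ * m * ‖v‖ ^ 2) * (κ * m * ‖u‖ ^ 2) := by ring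

end Prelim

/-! ## §2 The self-dual model (`χ = χʷ`) -/

section SelfDual

variable {V : Type*} [NormedAddCommGroup V] [InnerProductSpace ℂ V]

/-- **SELF-DUAL MODEL (`χ = χʷ`): every bracket letter discharged.**  One complex inner-product space `V` (the common section space with its `K`-pairing), `φ ∈ V ∖ 0`, `ψ : ℂ → V`
holomorphic on `D₁` (the continued `z ↦ M(z, χ)φ`), constants `κ, m > 0` (idelic bracket and `μ_K(K_U)`); `F : ℂ → H` holomorphic on `D₁` (to be `z ↦ [Λ^T Ẽ(φ, z)] ∈ L²(X)`) with the
four-bracket relation on the sub-tube for the brackets `κm⟪φ, φ⟫`, `κm⟪ψ z′, φ⟫`, `κm⟪φ, ψ z⟫`, `κm⟪ψ z′, ψ z⟫`.  THEN (a1)∧(a2)∧(a3) with `a = κm‖φ‖²`, `b(z) = κm‖ψ z‖²` at every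
`z ∈ D₁` — ★ `poleControl_continued_chi_cm_two_of_family_on` with its letters paid by §1. [cite: MoeglinWaldspurger1995, IV.2.3, IV.3.12 (a)] [cite: Arthur1980TraceFormulaII, §4] -/
theorem poleControl_continued_chi_cm_two_of_family_selfDual_on {D₁ : Set ℂ} (hD₁ : IsOpen D₁) (hD₁c : IsPreconnected D₁) (hD₁sub : D₁ ⊆ {z : ℂ | 1 / 2 < z.re ∧ 0 < z.im})
    (hbox₁ : {z : ℂ | (3 < z.re ∧ z.re < 4) ∧ 0 < z.im} ⊆ D₁) (hbox₂ : {z : ℂ | (1 < z.re ∧ z.re < 2) ∧ 0 < z.im} ⊆ D₁)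
    {T cμ K κ m : ℝ} (hT : 1 ≤ T) (hcμ : 0 < cμ) (hK : 0 < K) (hκ : 0 < κ) (hm : 0 < m) {φ : V} (hφ : φ ≠ 0) {ψ : ℂ → V} (hψ : DifferentiableOn ℂ ψ D₁)
    {H : Type*} [NormedAddCommGroup H] [InnerProductSpace ℂ H] (F : ℂ → H) (hFd : DifferentiableOn ℂ F D₁)
    (hrel : ∀ z ∈ D₁, ∀ z' ∈ D₁, 1 < z'.re → z'.re < z.re →
      ⟪F z', F z⟫_ℂ = ((cμ : ℝ) : ℂ) * (((K : ℝ) : ℂ) *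
        ((((T : ℝ) : ℂ) ^ (z + conj z' - 1) / (z + conj z' - 1)) * (((κ : ℝ) : ℂ) * (((m : ℝ) : ℂ) * ⟪φ, φ⟫_ℂ))
          + (((T : ℝ) : ℂ) ^ (z - conj z') / (z - conj z')) * (((κ : ℝ) : ℂ) * (((m : ℝ) : ℂ) * ⟪ψ z', φ⟫_ℂ))
          - (((T : ℝ) : ℂ) ^ (-(z - conj z')) / (z - conj z')) * (((κ : ℝ) : ℂ) * (((m : ℝ) : ℂ) * ⟪φ, ψ z⟫_ℂ))
          - (((T : ℝ) : ℂ) ^ (-(z + conj z' - 1)) / (z + conj z' - 1)) * (((κ : ℝ) : ℂ) * (((m : ℝ) : ℂ) * ⟪ψ z', ψ z⟫_ℂ)))))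
    {z : ℂ} (hz : z ∈ D₁) :
    Real.sqrt (κ * m * ‖ψ z‖ ^ 2) ≤ (z.re - 1 / 2) * T ^ (2 * (z.re - 1 / 2)) * Real.sqrt (κ * m * ‖φ‖ ^ 2) / |z.im| +
        Real.sqrt ((z.re - 1 / 2) ^ 2 * T ^ (4 * (z.re - 1 / 2)) * (κ * m * ‖φ‖ ^ 2) / z.im ^ 2 + (κ * m * ‖φ‖ ^ 2) * T ^ (4 * (z.re - 1 / 2))) ∧
      (∀ {x₁ x₂ η : ℝ}, 0 < x₁ → (z.re - 1 / 2) ∈ Set.Icc x₁ x₂ → 0 < η → η ≤ |z.im| →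
        κ * m * ‖ψ z‖ ^ 2 ≤ (x₂ * T ^ (2 * x₂) * Real.sqrt (κ * m * ‖φ‖ ^ 2) / η + Real.sqrt (x₂ ^ 2 * T ^ (4 * x₂) * (κ * m * ‖φ‖ ^ 2) / η ^ 2 + (κ * m * ‖φ‖ ^ 2) * T ^ (4 * x₂))) ^ 2) ∧
      (|z.im| ≤ 1 → κ * m * ‖ψ z‖ ^ 2 ≤ ((z.re - 1 / 2) * T ^ (2 * (z.re - 1 / 2)) * Real.sqrt (κ * m * ‖φ‖ ^ 2) +
        Real.sqrt ((z.re - 1 / 2) ^ 2 * T ^ (4 * (z.re - 1 / 2)) * (κ * m * ‖φ‖ ^ 2) + (κ * m * ‖φ‖ ^ 2) * T ^ (4 * (z.re - 1 / 2)))) ^ 2 / z.im ^ 2) := by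
  have hφn : 0 < ‖φ‖ := norm_pos_iff.2 hφ
  have ha : 0 < κ * m * ‖φ‖ ^ 2 := by positivity
  have hB₂ : DifferentiableOn ℂ (fun w : ℂ => ((κ : ℝ) : ℂ) * (((m : ℝ) : ℂ) * ⟪ψ (conj w), φ⟫_ℂ)) {w : ℂ | conj w ∈ D₁} :=
    ((differentiableOn_inner_conj_comp hD₁ hψ φ).const_mul _).const_mul _
  have hB₃ : DifferentiableOn ℂ (fun z : ℂ => ((κ : ℝ) : ℂ) * (((m : ℝ) : ℂ) * ⟪φ, ψ z⟫_ℂ)) D₁ :=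
    (((innerSL ℂ φ).differentiable.comp_differentiableOn hψ).const_mul _).const_mul _
  have hB₃₂ : ∀ z ∈ D₁, ((κ : ℝ) : ℂ) * (((m : ℝ) : ℂ) * ⟪φ, ψ z⟫_ℂ) = conj (((κ : ℝ) : ℂ) * (((m : ℝ) : ℂ) * ⟪ψ z, φ⟫_ℂ)) := fun z _ => by
    rw [map_mul, map_mul, Complex.conj_ofReal, Complex.conj_ofReal, inner_conj_symm]
  have hB₄₁ : ∀ z' ∈ D₁, DifferentiableOn ℂ (fun z : ℂ => ((κ : ℝ) : ℂ) * (((m : ℝ) : ℂ) * ⟪ψ z', ψ z⟫_ℂ)) D₁ := fun z' _ =>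
    (((innerSL ℂ (ψ z')).differentiable.comp_differentiableOn hψ).const_mul _).const_mul _
  have hB₄₂ : ∀ z ∈ D₁, DifferentiableOn ℂ (fun w : ℂ => ((κ : ℝ) : ℂ) * (((m : ℝ) : ℂ) * ⟪ψ (conj w), ψ z⟫_ℂ)) {w : ℂ | conj w ∈ D₁} := fun z _ =>
    ((differentiableOn_inner_conj_comp hD₁ hψ (ψ z)).const_mul _).const_mul _
  exact poleControl_continued_chi_cm_two_of_family_on hD₁ hD₁c hD₁sub hbox₁ hbox₂ hT hcμ hK ha (b := fun z => κ * m * ‖ψ z‖ ^ 2) (fun z _ => by positivity)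
    (B₁ := ((κ : ℝ) : ℂ) * (((m : ℝ) : ℂ) * ⟪φ, φ⟫_ℂ)) (B₂ := fun z' => ((κ : ℝ) : ℂ) * (((m : ℝ) : ℂ) * ⟪ψ z', φ⟫_ℂ))
    (B₃ := fun z => ((κ : ℝ) : ℂ) * (((m : ℝ) : ℂ) * ⟪φ, ψ z⟫_ℂ)) (B₄ := fun z z' => ((κ : ℝ) : ℂ) * (((m : ℝ) : ℂ) * ⟪ψ z', ψ z⟫_ℂ))
    (real_mul_inner_self κ m φ) hB₂ hB₃ hB₃₂ hB₄₁ hB₄₂ (fun z _ => real_mul_inner_self κ m (ψ z)) (fun z _ => norm_sq_real_mul_inner_le hκ.le hm.le (ψ z) φ) F hFd hrel hz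

end SelfDual

/-! ## §3 The off-dual model (`χ ≠ χʷ`): a `y`-free bound — no pole at all -/

section OffDual

variable {V : Type*} [NormedAddCommGroup V] [InnerProductSpace ℂ V] {V' : Type*} [NormedAddCommGroup V'] [InnerProductSpace ℂ V']

/-- **OFF-DUAL MODEL (`χ ≠ χʷ`): the two-term relation gives a `y`-FREE bound — NO POLE AT ALL on `D₁`.**  `φ ∈ V ∖ 0`, `ψ : ℂ → V′` holomorphic on `D₁` into a second inner-product
space (the continued `M(z, χ)φ ∈ V(χʷ, τ, U)`), real `κ, m` (no sign needed); `F : ℂ → H` holomorphic on `D₁` with `⟪F z′, F z⟫ = cμ·K·(T^{s₁}∕s₁·κm⟪φ, φ⟫ − T^{−s₁}∕s₁·κm⟪ψ z′, ψ z⟫)` on the sub-tube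
(the cross brackets vanish by orthogonality of `χ ≠ χʷ`).  THEN `κm‖ψ z‖² ≤ T^{4(Re z − ½)}·κm‖φ‖²` at every `z ∈ D₁` — uniformly in `y = Im z` (★ `diag_eq_fourBracket_of_pairing_on` with
`B₂ = B₃ = 0`, ★ `pairing_of_differentiableOn`, then `le_of_twoTerm` on the diagonal). [cite: MoeglinWaldspurger1995, IV.1.11, IV.3.12 (a)] [cite: Arthur1980TraceFormulaII, §4] -/
theorem normSq_le_of_family_offDual_on {D₁ : Set ℂ} (hD₁ : IsOpen D₁) (hD₁c : IsPreconnected D₁) (hD₁sub : D₁ ⊆ {z : ℂ | 1 / 2 < z.re ∧ 0 < z.im})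
    (hbox₁ : {z : ℂ | (3 < z.re ∧ z.re < 4) ∧ 0 < z.im} ⊆ D₁) (hbox₂ : {z : ℂ | (1 < z.re ∧ z.re < 2) ∧ 0 < z.im} ⊆ D₁)
    {T cμ K : ℝ} (hT : 1 ≤ T) (hcμ : 0 < cμ) (hK : 0 < K) (κ m : ℝ) (φ : V) {ψ : ℂ → V'} (hψ : DifferentiableOn ℂ ψ D₁)
    {H : Type*} [NormedAddCommGroup H] [InnerProductSpace ℂ H] (F : ℂ → H) (hFd : DifferentiableOn ℂ F D₁)
    (hrel : ∀ z ∈ D₁, ∀ z' ∈ D₁, 1 < z'.re → z'.re < z.re →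
      ⟪F z', F z⟫_ℂ = ((cμ : ℝ) : ℂ) * (((K : ℝ) : ℂ) *
        ((((T : ℝ) : ℂ) ^ (z + conj z' - 1) / (z + conj z' - 1)) * (((κ : ℝ) : ℂ) * (((m : ℝ) : ℂ) * ⟪φ, φ⟫_ℂ))
          - (((T : ℝ) : ℂ) ^ (-(z + conj z' - 1)) / (z + conj z' - 1)) * (((κ : ℝ) : ℂ) * (((m : ℝ) : ℂ) * ⟪ψ z', ψ z⟫_ℂ)))))
    {z : ℂ} (hz : z ∈ D₁) :
    κ * m * ‖ψ z‖ ^ 2 ≤ T ^ (4 * (z.re - 1 / 2)) * (κ * m * ‖φ‖ ^ 2) := by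
  have hT0 : 0 < T := lt_of_lt_of_le one_pos hT
  -- the relation in four-bracket shape with `B₂ = B₃ = 0`
  have hrel' : ∀ z ∈ D₁, ∀ z' ∈ D₁, 1 < z'.re → z'.re < z.re →
      ⟪F z', F z⟫_ℂ = ((cμ : ℝ) : ℂ) * (((K : ℝ) : ℂ) *
        ((((T : ℝ) : ℂ) ^ (z + conj z' - 1) / (z + conj z' - 1)) * (((κ : ℝ) : ℂ) * (((m : ℝ) : ℂ) * ⟪φ, φ⟫_ℂ))
          + (((T : ℝ) : ℂ) ^ (z - conj z') / (z - conj z')) * (fun _ : ℂ => (0 : ℂ)) z'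
          - (((T : ℝ) : ℂ) ^ (-(z - conj z')) / (z - conj z')) * (fun _ : ℂ => (0 : ℂ)) z
          - (((T : ℝ) : ℂ) ^ (-(z + conj z' - 1)) / (z + conj z' - 1)) * (((κ : ℝ) : ℂ) * (((m : ℝ) : ℂ) * ⟪ψ z', ψ z⟫_ℂ)))) := by
    intro z hz z' hz' h1 h2
    rw [hrel z hz z' hz' h1 h2]
    ring
  obtain ⟨hΦ₁, hΦ₂, hQ⟩ := pairing_of_differentiableOn hD₁ hFd
  have hB₄₁ : ∀ z' ∈ D₁, DifferentiableOn ℂ (fun z : ℂ => ((κ : ℝ) : ℂ) * (((m : ℝ) : ℂ) * ⟪ψ z', ψ z⟫_ℂ)) D₁ := fun z' _ =>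
    (((innerSL ℂ (ψ z')).differentiable.comp_differentiableOn hψ).const_mul _).const_mul _
  have hB₄₂ : ∀ z ∈ D₁, DifferentiableOn ℂ (fun w : ℂ => ((κ : ℝ) : ℂ) * (((m : ℝ) : ℂ) * ⟪ψ (conj w), ψ z⟫_ℂ)) {w : ℂ | conj w ∈ D₁} := fun z _ =>
    ((differentiableOn_inner_conj_comp hD₁ hψ (ψ z)).const_mul _).const_mul _
  have hdiag := diag_eq_fourBracket_of_pairing_on hD₁ hD₁c hD₁sub hbox₁ hbox₂ hT0 (cμ := cμ) (K := K)
    (B₁ := ((κ : ℝ) : ℂ) * (((m : ℝ) : ℂ) * ⟪φ, φ⟫_ℂ)) (B₂ := fun _ : ℂ => (0 : ℂ)) (B₃ := fun _ : ℂ => (0 : ℂ))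
    (B₄ := fun z z' => ((κ : ℝ) : ℂ) * (((m : ℝ) : ℂ) * ⟪ψ z', ψ z⟫_ℂ)) (differentiableOn_const (0 : ℂ)) (differentiableOn_const (0 : ℂ)) hB₄₁ hB₄₂
    (Φ := fun z z' => ⟪F z', F z⟫_ℂ) hΦ₁ hΦ₂ hrel' hz
  obtain ⟨hQ0, hQeq⟩ := hQ z hz
  simp only [mul_zero, add_zero, sub_zero] at hdiag
  rw [hQeq, real_mul_inner_self κ m φ, real_mul_inner_self κ m (ψ z)] at hdiag
  have hx : 0 < z.re - 1 / 2 := by linarith [(hD₁sub hz).1]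
  exact le_of_twoTerm hcμ hK hT0 hx hQ0 (add_conj_sub_one_eq z).1 hdiag

end OffDual

end Summit.HodgeConjecture.HodgeConjecture.Cruxes.H413.K2E1ChiMaassSelbergContinuedModelsCMTwo

end
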